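/-
Copyright (c) 2026 the pub-hodgecm-mathlib formalisation cell (harness21).  Prover seat hodgecm-mathlib-A-p12 (g36): P6b wave B row QB3 (2-II) «RING → SCHEME:
the Spec form of sheet (A)» (DEALS v8, interim dealer desk F0P6d-plan (g8) «P6d-D1», LEAD F0P6-plan (g8) «M-152x», desk F0P6b-plan (g14); box LA-ref2 (g7)),
2026-09-03.
-/
import Literature.AlgebraicGeometry.GroupSchemes.FiniteFlatGroupSchemeQuotientAffineTorsor
import Literature.AlgebraicGeometry.GroupSchemes.AffineGroupSchemeIsoSpec
import Mathlib.AlgebraicGeometry.Morphisms.Flat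
import Mathlib.AlgebraicGeometry.Morphisms.Finite
import Literature.AlgebraicGeometry.GroupSchemes.FiniteFlatGroupSchemeQuotientAffineIntegral
import Mathlib.CategoryTheory.Monoidal.Cartesian.Mod
import HarnessLib

/-!
# Quotient of an affine scheme by a free action of a finite locally free group scheme: the chart `U → Spec Γ(U)^Z` is an fppf torsor (Spec form of sheet (A))

Topic `AlgebraicGeometry/GroupSchemes`; namespace `Literature.AlgebraicGeometry.GroupSchemes.FiniteFlatQuotientAffine.Chart` (the object: ONE affine chart
`U → U⁄Z = Spec C₀` of the quotient of [MumfordAV1970] §12 Thm. 1 ∕ [SGA3I] Exp. V Thm. 4.1 ∕ [StacksProject] Tag 03BM, read on SCHEMES); THEOREMS ONLY (no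
definition, instance, notation or named fact; one `private` plumbing lemma); Mathlib-footed over ★ sheet (A) (`…QuotientAffineTorsor`: `torsorOverInvariants`, `exists_lift_productMap`,
`bijective_lift_productMap`, `finite_faithfullyFlat_invariants`) and the ★ points dictionary of affine `R`-schemes (`AffineGroupSchemeOfHopfAlgebra`: `Alg`,
`Alg.comap`, `coord`, `pt`; `HopfIdealClosedSubgroup`: `isoSpecOver`; `AffineGroupSchemeIsoSpec`: `coord_comp_isoSpecOver_hom`).  Cell `pub/hodgecm-mathlib`
(D-0151), programme P6 «MOD», wave B of the P6b fan-out towards №1 §Q `stub_L4B1uQ_quotientByFiniteFlatSubgroup` (Q0 census `CENSUS-Q-junction.v1` §1 Q4 +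
«Spec form of (A)»; row QB3 (2-II) of DEALS v8), lane `--supports stmt-HodgeConjecture-24832`; count-neutral (banked Row-4B capital).  HC_CM is proved only
modulo the printed citations (2 remaining named inputs hLiu418 = `stmt-HodgeConjecture-24832`, h413 = `stmt-HodgeConjecture-24833`) until rung 0 closes.

THE SETTING.  `R` a commutative ring, `G` an AFFINE group object and `U` an AFFINE `G`-object of `SchemeOver R = Over (Spec R)` (Mathlib `GrpObj G`,
`ModObj G U`, action `γ[G, U] : G ⊗ U ⟶ U`), `C := Alg U = Γ(U, 𝒪_U)`, `H := Alg G` with its ★ Hopf structure, and `ρ : C →ₐ[R] C ⊗[R] H` which IS THE ACTION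
READ ON GLOBAL SECTIONS — the interface token **(★ρ)** of row QB3 (2-I) (B-p04 (g53), ★-to-be `AffineGroupScheme.coaction`): `(lift (Γ(pr_U)) (Γ(pr_G))) ∘ ρ
= Γ(γ)` as maps `C → Γ(G ×_R U)`.  Invariants `C₀ := AlgHom.equalizer ρ includeLeft`; the CHART QUOTIENT MAP is any `q : U ⟶ Spec C₀` over `R` with
coordinates the inclusion (`coord q = C₀.val`; one exists: `coord_isoSpecOver_hom_comp_specOverMapOfAlgHom`).

THE THEOREMS ([MumfordAV1970] §12 Thm. 1 (A)(B) pp. 111–114, read on schemes; [GortzWedhorn2020] Def. 4.42∕(4.15) for the torsor square):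
* §1 points plumbing for affine `R`-schemes (`comap_injective`; the coordinates of `isoSpecOver ≫ Spec ψ`); §2 **the corner `G ×_R U ≅ Spec (Γ(U) ⊗[R] Γ(G))`**
  with coordinates `lift (Γ(pr_U)) (Γ(pr_G))` (`exists_cornerIso`, Yoneda through the two tautological points; no group structure needed);
* §3 from (★ρ): the points formula `(lift Γ(u) Γ(g)) ∘ ρ = Γ(g • u)` for ALL `T`-points (`lift_comap_comp_eq`), invariants are invariant
  (`comap_smul_apply_of_mem`), and **`γ ≫ q = pr_U ≫ q`** (`smul_comp_eq_comp`, `act_comp_eq_snd_comp`);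
* §4 `q = isoSpecOver ≫ Spec (C₀ ↪ C)`, hence **`q` is FINITE** when `C` is finite over `C₀` and **FLAT + SURJECTIVE** when `C` is faithfully flat over `C₀`
  (`isFinite_left`, `flat_left`, `surjective_left`; Mathlib `IsFinite.SpecMap_iff`, `flat_and_surjective_SpecMap_iff`) — conjuncts 1–2 of ★ `torsorOverInvariants`;
* §5 HEAD **`isPullback_left : IsPullback γ.left pr_U.left q.left q.left`** and its `Over`-form `isPullback`: the square `G ×_R U ⇉ U → Spec C₀` is CARTESIAN
  (`U → Spec C₀` is an fppf `G`-torsor): ★ `bijective_lift_productMap` (`C ⊗[C₀] C ≅ C ⊗[R] H`, `m ⊗ n ↦ (m ⊗ 1)·ρ n`) makes `C₀ → C ⇉ C ⊗[R] H` (legs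
  `includeLeft`, `ρ`) a PUSHOUT of rings (Mathlib `CommRingCat.isPushout_tensorProduct` + `IsPushout.of_iso`), `Spec` turns it into a pullback (Mathlib
  `isPullback_SpecMap_of_isPushout`), and §2's corner with (★ρ) identifies `Spec ρ` with `γ`, `Spec includeLeft` with `pr_U` (`IsPullback.of_iso`);
* §6 HEAD **`exists_chart`**: the chart package (quotient affine of finite type over `R`, `q` finite ∕ flat ∕ surjective ∕ invariant, square
  cartesian) under sheet (A)'s three hypotheses (`hcoassoc`, `hcounit`, `hfree`, token shapes of ★ `torsorOverInvariants`), `H` finite free over Noetherian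
  `R`, `C` of finite type — the `hchart` slot of the Q5∕Q6∕Q7 spine (CQD token of row (7)), `a := γ[G, U]`.

## References
* [MumfordAV1970] D. Mumford, *Abelian Varieties* (1970), §12, Thm. 1 p. 111, proof pp. 112–115 ((A) p. 113, (B) p. 114).
* [SGA3I] M. Demazure, A. Grothendieck (eds.), *SGA 3, Tome I*, Exp. V (P. Gabriel), Thm. 4.1 (ii), (iv); [StacksProject] Tag 03BM (Prop. 39.23.9).
* [GortzWedhorn2020] U. Görtz, T. Wedhorn, *Algebraic Geometry I*, 2nd ed. (2020), (4.15), Def. 4.42, Def. 4.44 (pp. 116–117); [GortzWedhorn2023] *Algebraic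
  Geometry II* (2023), §(27.2) (p. 606) (`Hom_R(T, Spec A) = Hom(A, Γ(T))`).
-/

set_option autoImplicit false

-- Mathlib's `Over`/`Scheme` APIs are stated across semireducible wrappers (as in the ★ `GroupSchemes/AffineGroupScheme*` files).
set_option backward.isDefEq.respectTransparency false

universe u

open CategoryTheory CategoryTheory.Limits AlgebraicGeometry MonoidalCategory CartesianMonoidalCategory TensorProduct

noncomputable section

namespace Literature.AlgebraicGeometry.GroupSchemes.FiniteFlatQuotientAffine.Chart

open scoped MonObj

open Literature.AlgebraicGeometry.Motives AffineGroupScheme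

variable {R : Type u} [CommRing R]

/-! ## §1 Points of affine `R`-schemes through `Γ` -/

section Points

variable {U T : SchemeOver R} [IsAffine U.left]

/-- **A `T`-point of an AFFINE `R`-scheme `U` is determined by its effect on global sections**: `u ↦ Γ(u) = Alg.comap u` is injective on `T ⟶ U`
(★ `coord_injective` transported along ★ `isoSpecOver U : U ≅ Spec Γ(U)`). [cite: GortzWedhorn2023, §(27.2) (p. 606)] -/
theorem comap_injective : Function.Injective (Alg.comap : (T ⟶ U) → (Alg U →ₐ[R] Alg T)) := by
  intro u v h
  have h' : coord (u ≫ (isoSpecOver U).hom) = coord (v ≫ (isoSpecOver U).hom) := by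
    rw [coord_comp_isoSpecOver_hom, coord_comp_isoSpecOver_hom, h]
  simpa [cancel_mono] using coord_injective h'

/-- The point of `U` with coordinates `φ` is `pt φ ≫ (isoSpecOver U)⁻¹`: `Γ(pt φ ≫ isoSpecOver⁻¹) = φ`. [cite: GortzWedhorn2023, §(27.2) (p. 606)] -/
theorem comap_pt_comp_isoSpecOver_inv (φ : Alg U →ₐ[R] Alg T) : Alg.comap (pt φ ≫ (isoSpecOver U).inv) = φ := by
  rw [← coord_comp_isoSpecOver_hom, Category.assoc, Iso.inv_hom_id, Category.comp_id, coord_pt]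

omit [IsAffine U.left] in
/-- Unfolding ★ `coord`: `Γ(x)` followed by `Γ(Spec H) ≅ H` is `coord x`. [cite: GortzWedhorn2023, §(27.2) (p. 606)] -/
theorem comap_comp_algSpecOverEquiv_symm {H : Type u} [CommRing H] [Algebra R H] (x : T ⟶ specOver R H) :
    (Alg.comap x).comp (algSpecOverEquiv H).symm.toAlgHom = coord x := rfl

/-- **Coordinates of `U ≅ Spec Γ(U) → Spec H`**: for `ψ : H → Γ(U)`, `coord (isoSpecOver.hom ≫ Spec ψ) = ψ`. [cite: GortzWedhorn2023, §(27.2) (p. 606)] -/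
theorem coord_isoSpecOver_hom_comp_specOverMapOfAlgHom {H : Type u} [CommRing H] [Algebra R H] (ψ : H →ₐ[R] Alg U) :
    coord ((isoSpecOver U).hom ≫ AlgPoints.specOverMapOfAlgHom ψ) = ψ := by
  rw [coord_comp, coord_specOverMapOfAlgHom, ← AlgHom.comp_assoc, comap_comp_algSpecOverEquiv_symm, coord_isoSpecOver_hom,
    AlgHom.id_comp]

end Points

/-- `φ ∘ lift f g = lift (φ ∘ f) (φ ∘ g)` for `R`-algebra maps into commutative algebras (the pair of points `(f, g)` moved along `φ`); private
plumbing (Mathlib `Algebra.TensorProduct.ext'`). [folklore] -/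
private theorem algHom_comp_lift {A B C D : Type*} [CommRing A] [Algebra R A] [CommRing B] [Algebra R B] [CommRing C] [Algebra R C]
    [CommRing D] [Algebra R D] (φ : C →ₐ[R] D) (f : A →ₐ[R] C) (g : B →ₐ[R] C) :
    φ.comp (Algebra.TensorProduct.lift f g fun _ _ => .all _ _) =
      Algebra.TensorProduct.lift (φ.comp f) (φ.comp g) fun _ _ => .all _ _ := by
  apply Algebra.TensorProduct.ext'
  intro a b
  simp [Algebra.TensorProduct.lift_tmul]

/-! ## §2 The corner `G ×_R U ≅ Spec (Γ(U) ⊗[R] Γ(G))` -/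

section Corner

variable (G U : SchemeOver R) [IsAffine G.left] [IsAffine U.left]

/-- **The two tautological points of `Spec (Γ(U) ⊗ Γ(G))`**: `u₀` with `Γ(u₀) = (c ↦ c ⊗ 1)`, `g₀` with `Γ(g₀) = (h ↦ 1 ⊗ h)`. [cite: GortzWedhorn2023, §(27.2) (p. 606)] -/
theorem exists_taut_points :
    ∃ (u₀ : specOver R (Alg U ⊗[R] Alg G) ⟶ U) (g₀ : specOver R (Alg U ⊗[R] Alg G) ⟶ G),
      Alg.comap u₀ = (algSpecOverEquiv (Alg U ⊗[R] Alg G)).symm.toAlgHom.comp Algebra.TensorProduct.includeLeft ∧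
      Alg.comap g₀ = (algSpecOverEquiv (Alg U ⊗[R] Alg G)).symm.toAlgHom.comp Algebra.TensorProduct.includeRight :=
  ⟨pt ((algSpecOverEquiv (Alg U ⊗[R] Alg G)).symm.toAlgHom.comp Algebra.TensorProduct.includeLeft) ≫ (isoSpecOver U).inv,
    pt ((algSpecOverEquiv (Alg U ⊗[R] Alg G)).symm.toAlgHom.comp Algebra.TensorProduct.includeRight) ≫ (isoSpecOver G).inv,
    comap_pt_comp_isoSpecOver_inv _, comap_pt_comp_isoSpecOver_inv _⟩

/-- **The corner isomorphism `G ×_R U ≅ Spec (Γ(U) ⊗[R] Γ(G))` over `R`**, with coordinates `lift (Γ(pr_U)) (Γ(pr_G))`, `c ⊗ h ↦ pr_U^*(c)·pr_G^*(h)`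
(for AFFINE `G`, `U` over the affine base; Yoneda: the inverse is the pair `(g₀, u₀)` of tautological points, the two composites are the identity because their
coordinates are — ★ `coord_injective`, `comap_injective`). [cite: GortzWedhorn2023, §(27.2) (p. 606)] -/
theorem exists_cornerIso :
    ∃ E : G ⊗ U ≅ specOver R (Alg U ⊗[R] Alg G),
      coord E.hom = Algebra.TensorProduct.lift (Alg.comap (snd G U)) (Alg.comap (fst G U)) fun _ _ => .all _ _ := by
  obtain ⟨u₀, g₀, hu₀, hg₀⟩ := exists_taut_points (R := R) G U
  set φ : Alg U ⊗[R] Alg G →ₐ[R] Alg (G ⊗ U) :=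
    Algebra.TensorProduct.lift (Alg.comap (snd G U)) (Alg.comap (fst G U)) fun _ _ => .all _ _ with hφ
  have hcoord : coord (pt φ) = φ := coord_pt φ
  have h1 : pt φ ≫ g₀ = fst G U := by
    apply comap_injective
    rw [Alg.comap_comp, hg₀, ← AlgHom.comp_assoc, comap_comp_algSpecOverEquiv_symm, hcoord, hφ,
      Algebra.TensorProduct.lift_comp_includeRight']
  have h2 : pt φ ≫ u₀ = snd G U := by
    apply comap_injective
    rw [Alg.comap_comp, hu₀, ← AlgHom.comp_assoc, comap_comp_algSpecOverEquiv_symm, hcoord, hφ,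
      Algebra.TensorProduct.lift_comp_includeLeft]
  refine ⟨⟨pt φ, lift g₀ u₀, ?_, ?_⟩, hcoord⟩
  · exact CartesianMonoidalCategory.hom_ext _ _ (by rw [Category.assoc, lift_fst, Category.id_comp, h1])
      (by rw [Category.assoc, lift_snd, Category.id_comp, h2])
  · apply coord_injective
    rw [coord_comp, hcoord, hφ, algHom_comp_lift, ← Alg.comap_comp, ← Alg.comap_comp, lift_snd, lift_fst, hu₀, hg₀,
      ← algHom_comp_lift, Algebra.TensorProduct.lift_includeLeft_includeRight, AlgHom.comp_id]
    rfl

end Corner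

/-! ## §3 From (★ρ): the points formula and the invariance of the chart quotient map -/

section Chart

variable {G U : SchemeOver R} [GrpObj G] [ModObj G U] (ρ : Alg U →ₐ[R] Alg U ⊗[R] Alg G)
  (hρ : (Algebra.TensorProduct.lift (Alg.comap (snd G U)) (Alg.comap (fst G U)) fun _ _ => .all _ _).comp ρ = Alg.comap γ[G, U])

/-- The action map is the translate of the second projection by the first: `γ = pr_G • pr_U` (Mathlib `Hom.smul_def`).
[cite: GortzWedhorn2020, (4.15) and Definition 4.44 (p. 117)] -/
theorem act_eq_fst_smul_snd : γ[G, U] = fst G U • snd G U := by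
  rw [Hom.smul_def, lift_fst_snd, Category.id_comp]

include hρ in
/-- **(★ρ) on ALL `T`-valued points**: `(lift Γ(u) Γ(g)) ∘ ρ = Γ(g • u)` for `u ∈ U(T)`, `g ∈ G(T)` — the token (★ρ) is the case of the universal point
`(pr_U, pr_G)`, and every point `(u, g) = ⟨g, u⟩ ≫ (pr_U, pr_G)` is its translate (`Γ` is a functor). [cite: GortzWedhorn2020, (4.15) and Definition 4.44 (p. 117)] -/
theorem lift_comap_comp_eq {T : SchemeOver R} (u : T ⟶ U) (g : T ⟶ G) :
    (Algebra.TensorProduct.lift (Alg.comap u) (Alg.comap g) fun _ _ => .all _ _).comp ρ = Alg.comap (g • u) := by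
  have h := congrArg (fun ψ => (Alg.comap (lift g u)).comp ψ) hρ
  rw [← AlgHom.comp_assoc, algHom_comp_lift, ← Alg.comap_comp, ← Alg.comap_comp, lift_snd, lift_fst, ← Alg.comap_comp,
    ← Hom.smul_def] at h
  exact h

include hρ in
/-- **Invariant functions are invariant**: for `c ∈ C₀ = {c | ρ c = c ⊗ 1}` and all `T`-points, `Γ(g • u)(c) = Γ(u)(c)` ([MumfordAV1970] §12, p. 112: the
elements of `C₀` are the functions constant on orbits). [cite: MumfordAV1970, §12 Thm. 1 and its proof (pp. 111–112)] -/
theorem comap_smul_apply_of_mem {T : SchemeOver R} (g : T ⟶ G) (u : T ⟶ U) {c : Alg U}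
    (hc : c ∈ AlgHom.equalizer ρ (Algebra.TensorProduct.includeLeft : Alg U →ₐ[R] Alg U ⊗[R] Alg G)) :
    Alg.comap (g • u) c = Alg.comap u c := by
  have h := congrArg (fun φ => φ c) (lift_comap_comp_eq ρ hρ u g)
  simp only [AlgHom.comp_apply] at h
  rw [← h, (AlgHom.mem_equalizer _ _ _).1 hc, Algebra.TensorProduct.includeLeft_apply, Algebra.TensorProduct.lift_tmul,
    map_one, mul_one]

include hρ in
/-- **The chart quotient map is invariant on `T`-points**: `(g • u) ≫ q = u ≫ q` for any `q : U → Spec C₀` over `R` with coordinates the inclusion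
`C₀ ↪ Γ(U)` (the coordinates of both sides agree by `comap_smul_apply_of_mem`). [cite: MumfordAV1970, §12 Thm. 1 and its proof (pp. 111–112)] -/
theorem smul_comp_eq_comp
    (q : U ⟶ specOver R (AlgHom.equalizer ρ (Algebra.TensorProduct.includeLeft : Alg U →ₐ[R] Alg U ⊗[R] Alg G)))
    (hq : coord q = (AlgHom.equalizer ρ (Algebra.TensorProduct.includeLeft : Alg U →ₐ[R] Alg U ⊗[R] Alg G)).val)
    {T : SchemeOver R} (g : T ⟶ G) (u : T ⟶ U) : (g • u) ≫ q = u ≫ q := by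
  apply coord_injective
  rw [coord_comp, coord_comp, hq]
  ext c
  exact comap_smul_apply_of_mem ρ hρ g u c.2

include hρ in
/-- **`γ ≫ q = pr_U ≫ q`**: the chart quotient map coequalises the action and the projection (`γ = pr_G • pr_U`).
[cite: MumfordAV1970, §12 Thm. 1 and its proof (pp. 111–112)] -/
theorem act_comp_eq_snd_comp
    (q : U ⟶ specOver R (AlgHom.equalizer ρ (Algebra.TensorProduct.includeLeft : Alg U →ₐ[R] Alg U ⊗[R] Alg G)))
    (hq : coord q = (AlgHom.equalizer ρ (Algebra.TensorProduct.includeLeft : Alg U →ₐ[R] Alg U ⊗[R] Alg G)).val) :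
    γ[G, U] ≫ q = snd G U ≫ q := by
  rw [act_eq_fst_smul_snd]
  exact smul_comp_eq_comp ρ hρ q hq _ _

end Chart

/-! ## §4 `q` is `U ≅ Spec C → Spec C₀`; finite, flat, surjective -/

section Quotient

variable {G U : SchemeOver R} [IsAffine U.left] (ρ : Alg U →ₐ[R] Alg U ⊗[R] Alg G)

/-- **A chart quotient map with the right coordinates IS `U ≅ Spec Γ(U) → Spec C₀`** (a point of `Spec C₀` is determined by its coordinates).
[cite: GortzWedhorn2023, §(27.2) (p. 606)] -/
theorem eq_isoSpecOver_hom_comp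
    (q : U ⟶ specOver R (AlgHom.equalizer ρ (Algebra.TensorProduct.includeLeft : Alg U →ₐ[R] Alg U ⊗[R] Alg G)))
    (hq : coord q = (AlgHom.equalizer ρ (Algebra.TensorProduct.includeLeft : Alg U →ₐ[R] Alg U ⊗[R] Alg G)).val) :
    q = (isoSpecOver U).hom ≫ AlgPoints.specOverMapOfAlgHom
      (AlgHom.equalizer ρ (Algebra.TensorProduct.includeLeft : Alg U →ₐ[R] Alg U ⊗[R] Alg G)).val :=
  coord_injective (by rw [hq, coord_isoSpecOver_hom_comp_specOverMapOfAlgHom])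

/-- Its underlying scheme morphism: `q = (U ≅ Spec Γ(U)) ≫ Spec (C₀ → Γ(U))`. [cite: GortzWedhorn2023, §(27.2) (p. 606)] -/
theorem left_eq
    (q : U ⟶ specOver R (AlgHom.equalizer ρ (Algebra.TensorProduct.includeLeft : Alg U →ₐ[R] Alg U ⊗[R] Alg G)))
    (hq : coord q = (AlgHom.equalizer ρ (Algebra.TensorProduct.includeLeft : Alg U →ₐ[R] Alg U ⊗[R] Alg G)).val) :
    q.left = U.left.isoSpec.hom ≫ Spec.map (CommRingCat.ofHom (algebraMap
      (AlgHom.equalizer ρ (Algebra.TensorProduct.includeLeft : Alg U →ₐ[R] Alg U ⊗[R] Alg G)) (Alg U))) := by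
  rw [eq_isoSpecOver_hom_comp ρ q hq, Over.comp_left, AlgPoints.specOverMapOfAlgHom_left, isoSpecOver_hom_left]
  rfl

/-- **`q` is FINITE** when `Γ(U)` is a finite `C₀`-module ([MumfordAV1970] §12 Thm. 1 (A): `π : X → Y` finite; the input is conjunct 1 of ★
`torsorOverInvariants`; Mathlib `IsFinite.SpecMap_iff`). [cite: MumfordAV1970, §12 Thm. 1 (A) (pp. 111–113)] -/
theorem isFinite_left
    (hfin : Module.Finite (AlgHom.equalizer ρ (Algebra.TensorProduct.includeLeft : Alg U →ₐ[R] Alg U ⊗[R] Alg G)) (Alg U))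
    (q : U ⟶ specOver R (AlgHom.equalizer ρ (Algebra.TensorProduct.includeLeft : Alg U →ₐ[R] Alg U ⊗[R] Alg G)))
    (hq : coord q = (AlgHom.equalizer ρ (Algebra.TensorProduct.includeLeft : Alg U →ₐ[R] Alg U ⊗[R] Alg G)).val) :
    IsFinite q.left := by
  rw [left_eq ρ q hq]
  have : IsFinite (Spec.map (CommRingCat.ofHom (algebraMap
      (AlgHom.equalizer ρ (Algebra.TensorProduct.includeLeft : Alg U →ₐ[R] Alg U ⊗[R] Alg G)) (Alg U)))) := by
    rw [IsFinite.SpecMap_iff, CommRingCat.hom_ofHom, RingHom.finite_algebraMap]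
    exact hfin
  infer_instance

/-- **`q` is FLAT** when `Γ(U)` is faithfully flat over `C₀` ([MumfordAV1970] §12 Thm. 1 (A): `X → Y` locally free; input = conjunct 2 of ★
`torsorOverInvariants`; Mathlib `flat_and_surjective_SpecMap_iff`). [cite: MumfordAV1970, §12 Thm. 1 (A) (pp. 111–113)] -/
theorem flat_left
    (hff : Module.FaithfullyFlat (AlgHom.equalizer ρ (Algebra.TensorProduct.includeLeft : Alg U →ₐ[R] Alg U ⊗[R] Alg G)) (Alg U))
    (q : U ⟶ specOver R (AlgHom.equalizer ρ (Algebra.TensorProduct.includeLeft : Alg U →ₐ[R] Alg U ⊗[R] Alg G)))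
    (hq : coord q = (AlgHom.equalizer ρ (Algebra.TensorProduct.includeLeft : Alg U →ₐ[R] Alg U ⊗[R] Alg G)).val) :
    Flat q.left := by
  rw [left_eq ρ q hq]
  haveI := ((flat_and_surjective_SpecMap_iff (CommRingCat.ofHom (algebraMap
      (AlgHom.equalizer ρ (Algebra.TensorProduct.includeLeft : Alg U →ₐ[R] Alg U ⊗[R] Alg G)) (Alg U)))).2
    (by rw [CommRingCat.hom_ofHom, RingHom.faithfullyFlat_algebraMap_iff]; exact hff)).1
  infer_instance

/-- **`q` is SURJECTIVE** when `Γ(U)` is faithfully flat over `C₀` (faithfully flat ring maps are surjective on spectra; Mathlib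
`flat_and_surjective_SpecMap_iff`). [cite: MumfordAV1970, §12 Thm. 1 (A) (pp. 111–113)] -/
theorem surjective_left
    (hff : Module.FaithfullyFlat (AlgHom.equalizer ρ (Algebra.TensorProduct.includeLeft : Alg U →ₐ[R] Alg U ⊗[R] Alg G)) (Alg U))
    (q : U ⟶ specOver R (AlgHom.equalizer ρ (Algebra.TensorProduct.includeLeft : Alg U →ₐ[R] Alg U ⊗[R] Alg G)))
    (hq : coord q = (AlgHom.equalizer ρ (Algebra.TensorProduct.includeLeft : Alg U →ₐ[R] Alg U ⊗[R] Alg G)).val) :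
    Surjective q.left := by
  rw [left_eq ρ q hq]
  haveI := ((flat_and_surjective_SpecMap_iff (CommRingCat.ofHom (algebraMap
      (AlgHom.equalizer ρ (Algebra.TensorProduct.includeLeft : Alg U →ₐ[R] Alg U ⊗[R] Alg G)) (Alg U)))).2
    (by rw [CommRingCat.hom_ofHom, RingHom.faithfullyFlat_algebraMap_iff]; exact hff)).2
  infer_instance

end Quotient

/-! ## §5 The torsor square `G ×_R U ⇉ U → Spec C₀` is cartesian -/

section Torsor

variable {G U : SchemeOver R} [GrpObj G] [ModObj G U] [IsAffine G.left] [IsAffine U.left]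
  (ρ : Alg U →ₐ[R] Alg U ⊗[R] Alg G)
  (hρ : (Algebra.TensorProduct.lift (Alg.comap (snd G U)) (Alg.comap (fst G U)) fun _ _ => .all _ _).comp ρ = Alg.comap γ[G, U])

include hρ in
/-- **HEAD — the chart is an fppf torsor: `IsPullback γ.left pr_U.left q.left q.left`** ([MumfordAV1970] §12 Thm. 1 (B): «`X` is a principal fibre bundle
over `Y`», `(γ, pr_U) : G ×_R U ⥲ U ×_Y U`), for `Γ(G)` finite free, `Γ(U)` of finite type, `ρ` coassociative ∕ counital ∕ free (★ `torsorOverInvariants`'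
token shapes): ★ `bijective_lift_productMap` makes `C₀ → C ⇉ C ⊗[R] H` (legs `includeLeft`, `ρ`) a pushout of rings, `Spec` of it is a pullback (Mathlib
`isPullback_SpecMap_of_isPushout`), and §2's corner with (★ρ) carries `Spec ρ ↦ γ`, `Spec includeLeft ↦ pr_U`, `U ≅ Spec C` carries `Spec (C₀ ↪ C) ↦ q`
(Mathlib `IsPullback.of_iso`). [cite: MumfordAV1970, §12 Thm. 1 (B) (pp. 112–114)] [cite: GortzWedhorn2020, Definition 4.42 and (4.15) (pp. 116–117)]
[cite: StacksProject, Tag 03BM] -/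
theorem isPullback_left [Module.Free R (Alg G)] [Module.Finite R (Alg G)] [Algebra.FiniteType R (Alg U)]
    (hcoassoc : ∀ c : Alg U, TensorProduct.map LinearMap.id (Coalgebra.comul (R := R) (A := Alg G)) (ρ c) =
      TensorProduct.assoc R (Alg U) (Alg G) (Alg G) (TensorProduct.map ρ.toLinearMap LinearMap.id (ρ c)))
    (hcounit : ∀ c : Alg U, TensorProduct.rid R (Alg U)
      (TensorProduct.map LinearMap.id (Coalgebra.counit (R := R) (A := Alg G)) (ρ c)) = c)
    (hfree : Function.Surjective
      (Algebra.TensorProduct.productMap (Algebra.TensorProduct.includeLeft : Alg U →ₐ[R] Alg U ⊗[R] Alg G) ρ))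
    (q : U ⟶ specOver R (AlgHom.equalizer ρ (Algebra.TensorProduct.includeLeft : Alg U →ₐ[R] Alg U ⊗[R] Alg G)))
    (hq : coord q = (AlgHom.equalizer ρ (Algebra.TensorProduct.includeLeft : Alg U →ₐ[R] Alg U ⊗[R] Alg G)).val) :
    IsPullback (γ[G, U]).left (snd G U).left q.left q.left := by
  -- Step A: the ring square `C₀ → C ⇉ C ⊗[R] H` is a pushout.
  obtain ⟨θ', hθ'⟩ := exists_lift_productMap ρ
  let θE := AlgEquiv.ofBijective θ' (bijective_lift_productMap ρ hcoassoc hcounit hfree θ' hθ')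
  have hpush : IsPushout
      (CommRingCat.ofHom (algebraMap (AlgHom.equalizer ρ (Algebra.TensorProduct.includeLeft : Alg U →ₐ[R] Alg U ⊗[R] Alg G)) (Alg U)))
      (CommRingCat.ofHom (algebraMap (AlgHom.equalizer ρ (Algebra.TensorProduct.includeLeft : Alg U →ₐ[R] Alg U ⊗[R] Alg G)) (Alg U)))
      (CommRingCat.ofHom (Algebra.TensorProduct.includeLeft : Alg U →ₐ[R] Alg U ⊗[R] Alg G).toRingHom)
      (CommRingCat.ofHom ρ.toRingHom) := by
    refine (CommRingCat.isPushout_tensorProduct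
      (AlgHom.equalizer ρ (Algebra.TensorProduct.includeLeft : Alg U →ₐ[R] Alg U ⊗[R] Alg G)) (Alg U) (Alg U)).of_iso
      (Iso.refl _) (Iso.refl _) (Iso.refl _) θE.toRingEquiv.toCommRingCatIso (by simp) (by simp) ?_ ?_
    · ext m
      change θ' (m ⊗ₜ[(AlgHom.equalizer ρ (Algebra.TensorProduct.includeLeft : Alg U →ₐ[R] Alg U ⊗[R] Alg G))] 1) = m ⊗ₜ[R] 1
      rw [hθ', map_one, mul_one]
    · ext n
      change θ' (1 ⊗ₜ[(AlgHom.equalizer ρ (Algebra.TensorProduct.includeLeft : Alg U →ₐ[R] Alg U ⊗[R] Alg G))] n) = ρ n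
      rw [hθ', ← Algebra.TensorProduct.one_def, one_mul]
  have hSpec := (isPullback_SpecMap_of_isPushout _ _ _ _ hpush).flip  -- … hence `Spec` of it is a pullback.
  -- Step B: the corner of §2; under it `Spec includeLeft` is `pr_U` and, by (★ρ), `Spec ρ` is `γ`.
  obtain ⟨E, hE⟩ := exists_cornerIso G U
  have hE1 : E.hom ≫ AlgPoints.specOverMapOfAlgHom (Algebra.TensorProduct.includeLeft : Alg U →ₐ[R] Alg U ⊗[R] Alg G) =
      snd G U ≫ (isoSpecOver U).hom := by
    apply coord_injective
    rw [coord_comp, coord_specOverMapOfAlgHom, ← AlgHom.comp_assoc, comap_comp_algSpecOverEquiv_symm, hE,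
      Algebra.TensorProduct.lift_comp_includeLeft, coord_comp_isoSpecOver_hom]
  have hE2 : E.hom ≫ AlgPoints.specOverMapOfAlgHom ρ = γ[G, U] ≫ (isoSpecOver U).hom := by
    apply coord_injective
    rw [coord_comp, coord_specOverMapOfAlgHom, ← AlgHom.comp_assoc, comap_comp_algSpecOverEquiv_symm, hE, hρ,
      coord_comp_isoSpecOver_hom]
  have hq' := eq_isoSpecOver_hom_comp ρ q hq
  -- Step C: transport along the corner, `U ≅ Spec C` (twice) and the identity of `Spec C₀`.
  have c1 : AlgPoints.specOverMapOfAlgHom ρ ≫ (isoSpecOver U).inv = E.inv ≫ γ[G, U] := by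
    rw [← cancel_epi E.hom, ← Category.assoc, hE2, Category.assoc, Iso.hom_inv_id, Category.comp_id, Iso.hom_inv_id_assoc]
  have c2 : AlgPoints.specOverMapOfAlgHom (Algebra.TensorProduct.includeLeft : Alg U →ₐ[R] Alg U ⊗[R] Alg G) ≫
      (isoSpecOver U).inv = E.inv ≫ snd G U := by
    rw [← cancel_epi E.hom, ← Category.assoc, hE1, Category.assoc, Iso.hom_inv_id, Category.comp_id, Iso.hom_inv_id_assoc]
  have c3 : AlgPoints.specOverMapOfAlgHom
      (AlgHom.equalizer ρ (Algebra.TensorProduct.includeLeft : Alg U →ₐ[R] Alg U ⊗[R] Alg G)).val =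
      (isoSpecOver U).inv ≫ q := by
    rw [hq', Iso.inv_hom_id_assoc]
  have c1' := congrArg CommaMorphism.left c1; have c2' := congrArg CommaMorphism.left c2; have c3' := congrArg CommaMorphism.left c3
  simp only [Over.comp_left, AlgPoints.specOverMapOfAlgHom_left] at c1' c2' c3'
  change Spec.map (CommRingCat.ofHom (algebraMap
      (AlgHom.equalizer ρ (Algebra.TensorProduct.includeLeft : Alg U →ₐ[R] Alg U ⊗[R] Alg G)) (Alg U))) = _ at c3'
  refine hSpec.of_iso ((Over.forget _).mapIso E).symm ((Over.forget _).mapIso (isoSpecOver U)).symm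
    ((Over.forget _).mapIso (isoSpecOver U)).symm (Iso.refl _) ?_ ?_ ?_ ?_
  exacts [by simpa using c1', by simpa using c2', by simpa using c3', by simpa using c3']

include hρ in
/-- **The torsor square in `Over (Spec R)`**: `IsPullback γ pr_U q q` (the forgetful functor to schemes reflects pullbacks; Mathlib `IsPullback.of_map`) —
the `Over`-level token of the group-law descent (Q8) and kernel-on-points (Q9) organs. [cite: MumfordAV1970, §12 Thm. 1 (B) (pp. 112–114)] -/
theorem isPullback [Module.Free R (Alg G)] [Module.Finite R (Alg G)] [Algebra.FiniteType R (Alg U)]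
    (hcoassoc : ∀ c : Alg U, TensorProduct.map LinearMap.id (Coalgebra.comul (R := R) (A := Alg G)) (ρ c) =
      TensorProduct.assoc R (Alg U) (Alg G) (Alg G) (TensorProduct.map ρ.toLinearMap LinearMap.id (ρ c)))
    (hcounit : ∀ c : Alg U, TensorProduct.rid R (Alg U)
      (TensorProduct.map LinearMap.id (Coalgebra.counit (R := R) (A := Alg G)) (ρ c)) = c)
    (hfree : Function.Surjective
      (Algebra.TensorProduct.productMap (Algebra.TensorProduct.includeLeft : Alg U →ₐ[R] Alg U ⊗[R] Alg G) ρ))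
    (q : U ⟶ specOver R (AlgHom.equalizer ρ (Algebra.TensorProduct.includeLeft : Alg U →ₐ[R] Alg U ⊗[R] Alg G)))
    (hq : coord q = (AlgHom.equalizer ρ (Algebra.TensorProduct.includeLeft : Alg U →ₐ[R] Alg U ⊗[R] Alg G)).val) :
    IsPullback γ[G, U] (snd G U) q q :=
  IsPullback.of_map (Over.forget _) (act_comp_eq_snd_comp ρ hρ q hq) (isPullback_left ρ hρ hcoassoc hcounit hfree q hq)

/-! ## §6 The chart package -/
include hρ in
/-- **HEAD — THE CHART EXISTS** (the `hchart` slot of the spine's charted-quotient datum, `a := γ[G, U]`): over a Noetherian `R`, for `Γ(G)` finite free,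
`Γ(U)` of finite type and `ρ` reading the action ((★ρ)), coassociative ∕ counital ∕ free, there are an AFFINE `R`-scheme `Q_U = Spec C₀` OF FINITE TYPE (★
`finiteType_invariants`, [MumfordAV1970] §12 Thm. 1 (A): `Y` is algebraic) and `q : U → Q_U` finite, flat, surjective, invariant, with `G ×_R U ⇉ U → Q_U`
cartesian. [cite: MumfordAV1970, §12 Thm. 1 (pp. 111–114)] [cite: SGA3I, Exp. V Thm. 4.1 (ii), (iv)] [cite: StacksProject, Tag 03BM] -/
theorem exists_chart [IsNoetherianRing R] [Module.Free R (Alg G)] [Module.Finite R (Alg G)] [Algebra.FiniteType R (Alg U)]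
    (hcoassoc : ∀ c : Alg U, TensorProduct.map LinearMap.id (Coalgebra.comul (R := R) (A := Alg G)) (ρ c) =
      TensorProduct.assoc R (Alg U) (Alg G) (Alg G) (TensorProduct.map ρ.toLinearMap LinearMap.id (ρ c)))
    (hcounit : ∀ c : Alg U, TensorProduct.rid R (Alg U)
      (TensorProduct.map LinearMap.id (Coalgebra.counit (R := R) (A := Alg G)) (ρ c)) = c)
    (hfree : Function.Surjective
      (Algebra.TensorProduct.productMap (Algebra.TensorProduct.includeLeft : Alg U →ₐ[R] Alg U ⊗[R] Alg G) ρ)) :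
    ∃ (QU : SchemeOver R) (q : U ⟶ QU), IsAffine QU.left ∧ LocallyOfFiniteType QU.hom ∧ IsFinite q.left ∧ Flat q.left ∧ Surjective q.left ∧
      γ[G, U] ≫ q = snd G U ≫ q ∧ IsPullback (γ[G, U]).left (snd G U).left q.left q.left := by
  have hA := torsorOverInvariants ρ hcoassoc hcounit hfree
  have hft : LocallyOfFiniteType (specOver R (AlgHom.equalizer ρ
      (Algebra.TensorProduct.includeLeft : Alg U →ₐ[R] Alg U ⊗[R] Alg G))).hom := by
    change LocallyOfFiniteType (Spec.map _)
    rw [HasRingHomProperty.Spec_iff (P := @LocallyOfFiniteType), CommRingCat.hom_ofHom, RingHom.finiteType_algebraMap]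
    exact finiteType_invariants ρ hcoassoc hcounit
  refine ⟨_, (isoSpecOver U).hom ≫ AlgPoints.specOverMapOfAlgHom (AlgHom.equalizer ρ
      (Algebra.TensorProduct.includeLeft : Alg U →ₐ[R] Alg U ⊗[R] Alg G)).val, inferInstanceAs (IsAffine (Spec _)), hft, ?_⟩
  have hq := coord_isoSpecOver_hom_comp_specOverMapOfAlgHom (U := U)
    (AlgHom.equalizer ρ (Algebra.TensorProduct.includeLeft : Alg U →ₐ[R] Alg U ⊗[R] Alg G)).val
  exact ⟨isFinite_left ρ hA.1 _ hq, flat_left ρ hA.2.1 _ hq, surjective_left ρ hA.2.1 _ hq, act_comp_eq_snd_comp ρ hρ _ hq,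
    isPullback_left ρ hρ hcoassoc hcounit hfree _ hq⟩

end Torsor

end Literature.AlgebraicGeometry.GroupSchemes.FiniteFlatQuotientAffine.Chart

end
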